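import Mathlib
import Summits.Langlands.Langlands.Theses.QuadraticWindow
import Literature.NumberTheory.GaloisRepresentations.TwistedSumDecomposition
import Literature.NumberTheory.Automorphic.GaloisActionPlaces

/-!
# Sketch — first lemmas of the crux idea cards for `QuadraticWindow.TwistUnpackaging`
(planner crux-ideate, stmt-Langlands-10903, round 1, ideator 1).  Statements only (Props); nothing is
proved here.  Each `def … : Prop` is the "First lemma" of one card and must elaborate.
-/

namespace Summit.Langlands.Langlands.Cruxes.TwistUnpackaging.Sketch

open Literature Literature.NumberTheory.GaloisRepresentations

/-- **Card `prime-order-cyclic-unscrewing` — first lemma (finite-order analogue of HLTT Prop. 7.12 for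
ONE twist of prime order and its powers).**  `Γ` a topological group, `𝔉 ⊆ Γ` dense, `k` an algebraically
closed Hausdorff topological field of characteristic `0`, `d ≥ 1`, `p` a prime with `16 d² < p`,
`χ : Γ → kˣ` continuous with `χᵖ = 1`, `𝔈¹_f, 𝔈²_f` `d`-element multisets of non-zero elements
(`f ∈ 𝔉`), `J ⊆ ℕ` containing `0` and all but at most one exponent `< p`, and for `j ∈ J` continuous
semisimple `C_j : Γ → GL_{2d}(k)` whose characteristic roots at every `f ∈ 𝔉` are `𝔈¹_f ⊔ 𝔈²_f·χ(f)ʲ`.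
Then `C_0 ≃ ρ₁ ⊕ ρ₂` (stated through characteristic polynomials) for continuous semisimple
`ρ₁, ρ₂ : Γ → GL_d(k)` whose characteristic roots are `𝔈¹_f`, `𝔈²_f` at every `f ∈ 𝔉` with `χ(f) ≠ 1`. -/
def CyclicTwistUnscrewing : Prop :=
  ∀ (Γ : Type) [Group Γ] [TopologicalSpace Γ] [IsTopologicalGroup Γ] (𝔉 : Set Γ), Dense 𝔉 →
  ∀ (k : Type) [Field k] [IsAlgClosed k] [CharZero k] [TopologicalSpace k]
    [IsTopologicalDivisionRing k] [T2Space k] (d p : ℕ), 0 < d → p.Prime → 16 * d ^ 2 < p →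
  ∀ (χ : Γ →ₜ* kˣ), (∀ g, χ g ^ p = 1) →
  ∀ (𝔈₁ 𝔈₂ : Γ → Multiset k),
    (∀ f ∈ 𝔉, Multiset.card (𝔈₁ f) = d ∧ Multiset.card (𝔈₂ f) = d ∧
      (0 : k) ∉ 𝔈₁ f ∧ (0 : k) ∉ 𝔈₂ f) →
  ∀ (J : Set ℕ), 0 ∈ J → (Set.Iio p \ J).Subsingleton →
  ∀ (C : ℕ → FramedRep Γ k (2 * d)),
    (∀ j ∈ J, (C j).toContinuousRep.IsSemisimple) →
    (∀ j ∈ J, ∀ f ∈ 𝔉, (FramedRep.charpoly (C j) f).roots =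
      𝔈₁ f + (𝔈₂ f).map (· * (((χ f) ^ j : kˣ) : k))) →
  ∃ (ρ₁ ρ₂ : FramedRep Γ k d),
    ρ₁.toContinuousRep.IsSemisimple ∧ ρ₂.toContinuousRep.IsSemisimple ∧
    (∀ g, FramedRep.charpoly (C 0) g = FramedRep.charpoly ρ₁ g * FramedRep.charpoly ρ₂ g) ∧
    ∀ f ∈ 𝔉, χ f ≠ 1 →
      (FramedRep.charpoly ρ₁ f).roots = 𝔈₁ f ∧ (FramedRep.charpoly ρ₂ f).roots = 𝔈₂ f

/-- **Card `finite-candidate-pigeonhole` — first lemma (compactness of the candidate set).**  If a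
continuous semisimple `A : Γ → GL_{2d}(k)` admits, for every FINITE `T ⊆ 𝔉`, a decomposition
`A ≃ ρ₁ ⊕ ρ₂` (through characteristic polynomials) into continuous semisimple halves with the roots of
`ρ₁` prescribed on `T`, then one decomposition has the roots of `ρ₁` prescribed on all of `𝔉`
(the halves of `A` form finitely many isomorphism classes; antitone non-empty subsets of a finite set
have non-empty intersection). -/
def FiniteCandidateGluing : Prop :=
  ∀ (Γ : Type) [Group Γ] [TopologicalSpace Γ] [IsTopologicalGroup Γ]
    (k : Type) [Field k] [IsAlgClosed k] [CharZero k] [TopologicalSpace k]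
    [IsTopologicalDivisionRing k] [T2Space k] (d : ℕ) (A : FramedRep Γ k (2 * d)),
    A.toContinuousRep.IsSemisimple →
  ∀ (𝔉 : Set Γ) (𝔈₁ : Γ → Multiset k),
    (∀ T : Finset Γ, (↑T : Set Γ) ⊆ 𝔉 →
      ∃ (ρ₁ ρ₂ : FramedRep Γ k d),
        ρ₁.toContinuousRep.IsSemisimple ∧ ρ₂.toContinuousRep.IsSemisimple ∧
        (∀ g, FramedRep.charpoly A g = FramedRep.charpoly ρ₁ g * FramedRep.charpoly ρ₂ g) ∧
        ∀ f ∈ T, (FramedRep.charpoly ρ₁ f).roots = 𝔈₁ f) →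
    ∃ (ρ₁ ρ₂ : FramedRep Γ k d),
      ρ₁.toContinuousRep.IsSemisimple ∧ ρ₂.toContinuousRep.IsSemisimple ∧
      (∀ g, FramedRep.charpoly A g = FramedRep.charpoly ρ₁ g * FramedRep.charpoly ρ₂ g) ∧
      ∀ f ∈ 𝔉, (FramedRep.charpoly ρ₁ f).roots = 𝔈₁ f

/-- **Card `kummer-descent-detection` — first lemma (CFT-free detecting twists).**  For `F/F₀` quadratic
with non-trivial automorphism `τ`, an odd prime `p`, a finite set `S` of places of `F` away from `p`
(think: the places above `ℓ`) and a finite batch `T` of places `w` with `τ•w ≠ w` away from `p`, there is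
a character `e : Γ_F → GL_1(ℂ)` (Artin avatar) of order dividing `p`, unramified on `S`, trivial at
every complex conjugation (so the parity clause of the crux family holds), unramified at `w, τ•w` and
with DIFFERENT arithmetic-Frobenius values at `w` and `τ•w`, for every `w ∈ T`. -/
def KummerDescentDetection : Prop :=
  ∀ (F₀ F : Type) [Field F₀] [NumberField F₀] [Field F] [NumberField F] [Algebra F₀ F]
    (τ : F ≃ₐ[F₀] F), Module.finrank F₀ F = 2 → τ ≠ 1 →
  ∀ (p : ℕ), p.Prime → p ≠ 2 →
  ∀ (S T : Finset (IsDedekindDomain.HeightOneSpectrum (NumberField.RingOfIntegers F))),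
    (∀ v ∈ S, ((p : ℕ) : NumberField.RingOfIntegers F) ∉ v.asIdeal) →
    (∀ w ∈ T, τ • w ≠ w ∧ ((p : ℕ) : NumberField.RingOfIntegers F) ∉ w.asIdeal) →
  ∃ e : Literature.NumberTheory.GaloisRepresentations.FramedGaloisRep F ℂ 1,
    (∀ g, e g ^ p = 1) ∧
    (∀ v ∈ S, e.IsUnramifiedAt v) ∧
    (∀ (φ : F →+* ℝ) (c : Field.absoluteGaloisGroup F),
      Literature.NumberTheory.GaloisRepresentations.IsComplexConjugation φ c →
        Matrix.GeneralLinearGroup.det (e c) = 1) ∧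
    ∀ w ∈ T, e.IsUnramifiedAt w ∧ e.IsUnramifiedAt (τ • w) ∧
      ∃ c c' : ℂ, e.HasFrobCharpolyAt w (Polynomial.X - Polynomial.C c) ∧
        e.HasFrobCharpolyAt (τ • w) (Polynomial.X - Polynomial.C c') ∧ c ≠ c'

end Summit.Langlands.Langlands.Cruxes.TwistUnpackaging.Sketch
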